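import Summits.QuantumFields.YangMills.Theorems.FluctuationComparisonRegPrIntLS2BetaLiftOscillation
import Summits.QuantumFields.YangMills.Theorems.FluctuationComparisonRegPrIntLS2BetaRelativeLiftPairChord
import Summits.QuantumFields.YangMills.Theorems.FluctuationComparisonRegPrIntLS2BetaLogChordComparison
import Summits.QuantumFields.YangMills.Theorems.FluctuationComparisonRegPrIntLS2BetaLiftLadderCombRow
import Summits.QuantumFields.YangMills.Theorems.FluctuationComparisonRegPrIntLOrganTangentAnchorFreeOscillation
import HarnessLib

/-!
# S2β · OSC-LIFT (architect px17 g22, 21:10:55Z; ruling (β-3)′ (i) 19:55:50Z): THE OSCILLATION OF THE RELATIVE LIFT `R b := lift j X b·(lift j X₁ b)⁻¹` OVER ANY TWO FINE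
# BONDS is at most `(1 + (2L⁻¹σ)²∕3)·(L⁻¹·δ + 16·(L⁻¹σ)(L⁻¹r))` — `δ` the PARENT relative oscillation (log-difference currency) over the two hat supports, the rest the
# MIXED two-factor BCH price `O(σ·r∕L²)`

Cell `ym3-torus` (YM ladder rung R3 = continuum `SU(2)` Yang–Mills on the three-torus at fixed lattice data — a RUNG: NOT d = 4, NOT infinite volume, NOT a mass gap,
NOT Clay).  Width seat «width 12» `ym3-torus-px12` (gen 26), FREE px helper on crux `stmt-QuantumFields-20520`; `--kind proof --supports stmt-QuantumFields-20520 --as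
helper`, count-neutral, DEFINITION-FREE (0 `def`, 0 `instance`, 0 `notation`, 0 `sorry`, default heartbeats).

WHY ((β-3)′: the order-2 brick's remainder is `q·M·(OSC_R(X) + M·κ)`; with base field the lift, what is left of `OSC_R` is the oscillation OF THE RELATIVE LIFT over
the read region — this letter; the discrepancy `ε` is the rows' `D′`, the curvature half is px13's).  INPUTS, all landed by this seat today: the abelian core ✓p834158
`norm_liftRel_sub_liftRel_le_osc` (two convex combinations differ by at most the diameter: `L⁻¹·δ`, ANY two bonds), the two-factor BCH defect ✓p832616
`dist1_relChord_pair_le` (`dist1 (R₁R₀⁻¹) ≤ ‖d₁ − d₀‖ + 8‖a₁‖‖d₁‖ + 8‖a₀‖‖d₀‖`), ✓`arc_lift_le` (`‖a‖ ≤ L⁻¹σ`), ✓`norm_logVec_lift_sub_le` (`‖d‖ ≤ L⁻¹r`), and (L♭)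
✓`norm_logVec_sub_le_mul_dist1` (chord → log-difference, Jordan factor `1 + s²∕3`).

WHAT IS PROVED (sorry-free).
§1 (`expPoint (−x) = (expPoint x)⁻¹` is ✓`…OrganTangentAnchorFreeOscillation.expPoint_neg`, REUSED — first dry-run bounced `dedup.landed` on my copy) ★`dist1_liftChord_pair_le` (FILE F's telescope for the
   LEFT-read relative chord `e^{a}·(e^{a+d})⁻¹`: `dist1 ((e^{a₁}(e^{a₁+d₁})⁻¹)·(e^{a₀}(e^{a₀+d₀})⁻¹)⁻¹) ≤ ‖d₁ − d₀‖ + 8‖a₁‖‖d₁‖ + 8‖a₀‖‖d₀‖` for norms `≤ 1`).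
§2 ★★★`dist1_oscLift_le` (CHORD currency) and ★★★`osc_lift_le` (LOG currency, the architect's name): hat weights `w` (`hw`), coarse `X, X₁` with lifts `V, V₁` (`hV`, `hV₁`),
   ANY two fine bonds `b, b′`; hypotheses on the two hat supports (`w b e ≠ 0 ∨ w b′ e ≠ 0`): arcs of `X` AND `X₁` `≤ σ ≤ 1∕2`, log-differences `‖log X e − log X₁ e‖ ≤ r ≤ 1`,
   parent oscillation `‖(log X e − log X₁ e) − (log X e′ − log X₁ e′)‖ ≤ δ` for `w b e ≠ 0 ≠ w b′ e′`:
   **`‖logVec (su2Quat (V b·(V₁ b)⁻¹)) − logVec (su2Quat (V b′·(V₁ b′)⁻¹))‖ ≤ (1 + (2·(L⁻¹·σ))²∕3)·(L⁻¹·δ + 16·((L⁻¹·σ)·(L⁻¹·r)))`**.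
   A read region `R(c)` is covered by taking `max` over its bond pairs (the hypotheses then range over `N(c)` ⊇ the hat supports).
HONEST DIFFERENCE from the architect's display: the parent oscillation is in LOG-DIFFERENCE currency `D e := log X e − log X₁ e` (the lift is linear in `log X`, `log X₁`
separately); the chord-log currency `log (X e·(X₁ e)⁻¹)` differs from `D e` by one more mixed BCH `O(σ·r)` per coarse bond (not typed here); constant ONE in place of `c_lift`
on the `δ` term, the Jordan factor `≤ 1 + 1∕12` overall.

HONEST SCOPE.  Compositions of landed letters; sizes `σ, r, δ` HYPOTHESES; nothing of Bałaban's renormalisation-group analysis is asserted or proved ([Balaban1985RegularSpaces]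
(1.29) p.81 — the printed `L⁻¹` regularity of the lift; [Balaban1985Variational] (34) p.283 — the printed second-order expansion); (β-3)′ itself, its curvature half, `OSC_R`'s
docking, rows v2, (ST″), LOC, GAP♯∘ (`stub_uniformFibreGapOrbit`, registry 3732b7df UNTOUCHED), the five registered stubs (0∕5), S2β, 20520, 19936, 19200, `YM3TorusSU2` are
NOT proved; no registered stub is closed; rung R3 — NOT d = 4, NOT infinite volume, NOT a mass gap, NOT Clay; the Yang–Mills mass gap is NOT proved.
-/

set_option autoImplicit false

namespace Summit.QuantumFields.YangMills.Theorems.FluctuationComparisonRegPrIntLS2BetaOscLift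

open NormedSpace Finset
open scoped Real
open Literature.MathematicalPhysics.QuantumLattice (su2Quat quatToSU2_su2Quat)
open Literature.MathematicalPhysics.QuantumFieldTheory.Balaban1983to89
open T4Continuum
open B10Eq27TorusAxialLog (rel)
open T4CubeChartGnomonic (SU2)
open T4HaarSU2ExpChart (expPoint imQuat su2Quat_expPoint)
open T4HaarSU2Translate (su2Quat_mul su2Quat_one)
open T4ExpWindowSmallField (logVec expPoint_logVec)
open Summit.QuantumFields.YangMills.Theorems.FluctuationComparisonRegPrIntLS2BetaWhitneyHatLift (arc_lift_le)
open Summit.QuantumFields.YangMills.Theorems.FluctuationComparisonRegPrIntLS2BetaWhitneyHatLiftRelative (norm_logVec_lift_sub_le)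
open Summit.QuantumFields.YangMills.Theorems.FluctuationComparisonRegPrIntLS2BetaRelativeLiftPairChord (dist1_relChord_pair_le)
open Summit.QuantumFields.YangMills.Theorems.FluctuationComparisonRegPrIntLS2BetaLiftOscillation (norm_liftRel_sub_liftRel_le_osc)
open Summit.QuantumFields.YangMills.Theorems.FluctuationComparisonRegPrIntLS2BetaLogChordComparison (norm_logVec_sub_le_mul_dist1)
open Summit.QuantumFields.YangMills.Theorems.FluctuationComparisonRegPrIntLS2BetaArcBondSplit (norm_logVec_su2Quat_mul_le)
open Summit.QuantumFields.YangMills.Theorems.FluctuationComparisonRegPrIntLS2BetaLiftLadderCombRow (norm_logVec_su2Quat_inv)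
open Summit.QuantumFields.YangMills.Theorems.OrganTangentAnchorFreeOscillation (expPoint_neg)

/-! ## §1 The chart is odd-to-inverse; the telescope for the left-read relative chord -/

/-- ★ **THE TELESCOPE FOR THE LEFT-READ RELATIVE CHORD** `R_i := e^{a_i}·(e^{a_i+d_i})⁻¹` (`‖a_i‖, ‖d_i‖ ≤ 1`):
`dist1 (R₁·R₀⁻¹) ≤ ‖d₁ − d₀‖ + 8‖a₁‖‖d₁‖ + 8‖a₀‖‖d₀‖` (✓`dist1_relChord_pair_le` at `(−a_i, −d_i)` and `expPoint_neg`). [folklore] -/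
theorem dist1_liftChord_pair_le (a₀ d₀ a₁ d₁ : EuclideanSpace ℝ (Fin 3)) (ha₀ : ‖a₀‖ ≤ 1) (hd₀ : ‖d₀‖ ≤ 1) (ha₁ : ‖a₁‖ ≤ 1) (hd₁ : ‖d₁‖ ≤ 1) :
    dist1 ((expPoint a₁ * (expPoint (a₁ + d₁))⁻¹) * (expPoint a₀ * (expPoint (a₀ + d₀))⁻¹)⁻¹) ≤
      ‖d₁ - d₀‖ + 8 * (‖a₁‖ * ‖d₁‖) + 8 * (‖a₀‖ * ‖d₀‖) := by
  have h := dist1_relChord_pair_le (-a₀) (-d₀) (-a₁) (-d₁) (by rwa [norm_neg]) (by rwa [norm_neg]) (by rwa [norm_neg]) (by rwa [norm_neg])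
  have e1 : ∀ a d : EuclideanSpace ℝ (Fin 3), (expPoint (-a))⁻¹ * expPoint (-a + -d) = expPoint a * (expPoint (a + d))⁻¹ := by
    intro a d
    rw [expPoint_neg, inv_inv, show -a + -d = -(a + d) by abel, expPoint_neg]
  rw [e1, e1, norm_neg, norm_neg, norm_neg, norm_neg, show -d₁ - -d₀ = -(d₁ - d₀) by abel, norm_neg] at h
  exact h

/-! ## §2 OSC-LIFT -/

section Lift

variable {P : Params} {t : ℕ}

/-- ★★★ **OSC-LIFT, CHORD CURRENCY**: for ANY two fine bonds `b, b′`, with arcs of `X, X₁` `≤ σ ≤ 1∕2`, log-differences `≤ r ≤ 1` on the two hat supports and parent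
relative oscillation `≤ δ` across them: `dist1 (R b·(R b′)⁻¹) ≤ L⁻¹·δ + 16·((L⁻¹σ)(L⁻¹r))`, `R b := V b·(V₁ b)⁻¹`. [cite: Balaban1985RegularSpaces, (1.29) p.81] -/
theorem dist1_oscLift_le (ht : t + 1 ≤ P.m + P.K) (w : PBond P t → PBond P (t + 1) → ℝ)
    (hw : ∀ b e, w b e = if e.dir = b.dir ∧ (b.src b.dir - emb e.src b.dir).val < P.L then
      ∏ ν ∈ Finset.univ.erase b.dir, max 0 (1 - ((rel (emb e.src) b.src ν).natAbs : ℝ) / P.L) else 0)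
    (X X₁ : GaugeField P (t + 1) SU2) (V V₁ : GaugeField P t SU2)
    (hV : ∀ b, V b = expPoint (∑ e, w b e • ((P.L : ℝ)⁻¹ • logVec (su2Quat (X e)))))
    (hV₁ : ∀ b, V₁ b = expPoint (∑ e, w b e • ((P.L : ℝ)⁻¹ • logVec (su2Quat (X₁ e)))))
    (b b' : PBond P t) {σ r δ : ℝ} (hσ1 : σ ≤ 1) (hr1 : r ≤ 1)
    (hσ : ∀ e, (w b e ≠ 0 ∨ w b' e ≠ 0) → ‖logVec (su2Quat (X e))‖ ≤ σ)
    (hr : ∀ e, (w b e ≠ 0 ∨ w b' e ≠ 0) → ‖logVec (su2Quat (X e)) - logVec (su2Quat (X₁ e))‖ ≤ r)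
    (hδ : ∀ e e', w b e ≠ 0 → w b' e' ≠ 0 →
      ‖(logVec (su2Quat (X e)) - logVec (su2Quat (X₁ e))) - (logVec (su2Quat (X e')) - logVec (su2Quat (X₁ e')))‖ ≤ δ) :
    dist1 ((V b * (V₁ b)⁻¹) * (V b' * (V₁ b')⁻¹)⁻¹) ≤ (P.L : ℝ)⁻¹ * δ + 16 * (((P.L : ℝ)⁻¹ * σ) * ((P.L : ℝ)⁻¹ * r)) := by
  have hL0 : 0 ≤ (P.L : ℝ)⁻¹ := inv_nonneg.mpr (Nat.cast_nonneg _)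
  have hL1 : (P.L : ℝ)⁻¹ ≤ 1 := by
    have hL : (1 : ℝ) ≤ (P.L : ℝ) := by exact_mod_cast P.hL.2.le
    exact inv_le_one_of_one_le₀ hL
  have hLpos : 0 < (P.L : ℝ)⁻¹ := by
    have h2 : (0 : ℝ) < (P.L : ℝ) := by exact_mod_cast lt_trans zero_lt_one P.hL.2
    exact inv_pos.mpr h2
  -- sizes on each support
  have hA : ‖logVec (su2Quat (V b))‖ ≤ (P.L : ℝ)⁻¹ * σ := arc_lift_le ht w hw X V hV b fun e he => hσ e (Or.inl he)
  have hA' : ‖logVec (su2Quat (V b'))‖ ≤ (P.L : ℝ)⁻¹ * σ := arc_lift_le ht w hw X V hV b' fun e he => hσ e (Or.inr he)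
  have hD : ‖logVec (su2Quat (V₁ b)) - logVec (su2Quat (V b))‖ ≤ (P.L : ℝ)⁻¹ * r := by
    rw [norm_sub_rev]; exact norm_logVec_lift_sub_le ht w hw X X₁ V V₁ hV hV₁ b fun e he => hr e (Or.inl he)
  have hD' : ‖logVec (su2Quat (V₁ b')) - logVec (su2Quat (V b'))‖ ≤ (P.L : ℝ)⁻¹ * r := by
    rw [norm_sub_rev]; exact norm_logVec_lift_sub_le ht w hw X X₁ V V₁ hV hV₁ b' fun e he => hr e (Or.inr he)
  have hσ0 : 0 ≤ σ := (mul_nonneg_iff_of_pos_left hLpos).mp ((norm_nonneg _).trans hA)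
  have hr0 : 0 ≤ r := (mul_nonneg_iff_of_pos_left hLpos).mp ((norm_nonneg _).trans hD)
  have hLσ1 : (P.L : ℝ)⁻¹ * σ ≤ 1 := (mul_le_of_le_one_left hσ0 hL1).trans hσ1
  have hLr1 : (P.L : ℝ)⁻¹ * r ≤ 1 := (mul_le_of_le_one_left hr0 hL1).trans hr1
  -- the four bond values through their logs
  have eV : V b = expPoint (logVec (su2Quat (V b))) := (expPoint_logVec (V b)).symm
  have eV' : V b' = expPoint (logVec (su2Quat (V b'))) := (expPoint_logVec (V b')).symm
  have eV₁ : V₁ b = expPoint (logVec (su2Quat (V b)) + (logVec (su2Quat (V₁ b)) - logVec (su2Quat (V b)))) := by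
    rw [add_sub_cancel]; exact (expPoint_logVec (V₁ b)).symm
  have eV₁' : V₁ b' = expPoint (logVec (su2Quat (V b')) + (logVec (su2Quat (V₁ b')) - logVec (su2Quat (V b')))) := by
    rw [add_sub_cancel]; exact (expPoint_logVec (V₁ b')).symm
  have key := dist1_liftChord_pair_le (logVec (su2Quat (V b'))) (logVec (su2Quat (V₁ b')) - logVec (su2Quat (V b')))
    (logVec (su2Quat (V b))) (logVec (su2Quat (V₁ b)) - logVec (su2Quat (V b)))
    (hA'.trans hLσ1) (hD'.trans hLr1) (hA.trans hLσ1) (hD.trans hLr1)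
  rw [← eV, ← eV', ← eV₁, ← eV₁'] at key
  -- the main term: the abelian core (✓p834158), ANY two bonds
  have hmain : ‖(logVec (su2Quat (V₁ b)) - logVec (su2Quat (V b))) - (logVec (su2Quat (V₁ b')) - logVec (su2Quat (V b')))‖ ≤ (P.L : ℝ)⁻¹ * δ := by
    have h := norm_liftRel_sub_liftRel_le_osc ht w hw X X₁ V V₁ hV hV₁ b b' hδ
    have e3 : (logVec (su2Quat (V₁ b)) - logVec (su2Quat (V b))) - (logVec (su2Quat (V₁ b')) - logVec (su2Quat (V b'))) =
        -((logVec (su2Quat (V b)) - logVec (su2Quat (V₁ b))) - (logVec (su2Quat (V b')) - logVec (su2Quat (V₁ b')))) := by abel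
    rw [e3, norm_neg]; exact h
  have hp : ‖logVec (su2Quat (V b))‖ * ‖logVec (su2Quat (V₁ b)) - logVec (su2Quat (V b))‖ ≤ ((P.L : ℝ)⁻¹ * σ) * ((P.L : ℝ)⁻¹ * r) :=
    mul_le_mul hA hD (norm_nonneg _) ((norm_nonneg _).trans hA)
  have hp' : ‖logVec (su2Quat (V b'))‖ * ‖logVec (su2Quat (V₁ b')) - logVec (su2Quat (V b'))‖ ≤ ((P.L : ℝ)⁻¹ * σ) * ((P.L : ℝ)⁻¹ * r) :=
    mul_le_mul hA' hD' (norm_nonneg _) ((norm_nonneg _).trans hA')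
  linarith [key, hmain, hp, hp']

/-- ★★★ **OSC-LIFT** (the architect's letter, LOG currency): under the hypotheses of `dist1_oscLift_le` with `σ ≤ 1∕2`,
`‖log (V b·(V₁ b)⁻¹) − log (V b′·(V₁ b′)⁻¹)‖ ≤ (1 + (2·(L⁻¹σ))²∕3)·(L⁻¹·δ + 16·((L⁻¹σ)(L⁻¹r)))` — the oscillation of the RELATIVE LIFT over any two fine bonds is the
parent relative oscillation with the lift's `L⁻¹`, plus the mixed BCH price, times the (L♭) Jordan factor of the two relative arcs `≤ 2L⁻¹σ`. [cite: Balaban1985RegularSpaces, (1.29) p.81] -/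
theorem osc_lift_le (ht : t + 1 ≤ P.m + P.K) (w : PBond P t → PBond P (t + 1) → ℝ)
    (hw : ∀ b e, w b e = if e.dir = b.dir ∧ (b.src b.dir - emb e.src b.dir).val < P.L then
      ∏ ν ∈ Finset.univ.erase b.dir, max 0 (1 - ((rel (emb e.src) b.src ν).natAbs : ℝ) / P.L) else 0)
    (X X₁ : GaugeField P (t + 1) SU2) (V V₁ : GaugeField P t SU2)
    (hV : ∀ b, V b = expPoint (∑ e, w b e • ((P.L : ℝ)⁻¹ • logVec (su2Quat (X e)))))
    (hV₁ : ∀ b, V₁ b = expPoint (∑ e, w b e • ((P.L : ℝ)⁻¹ • logVec (su2Quat (X₁ e)))))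
    (b b' : PBond P t) {σ r δ : ℝ} (hσ2 : σ ≤ 1 / 2) (hr1 : r ≤ 1)
    (hσ : ∀ e, (w b e ≠ 0 ∨ w b' e ≠ 0) → ‖logVec (su2Quat (X e))‖ ≤ σ)
    (hσ₁ : ∀ e, (w b e ≠ 0 ∨ w b' e ≠ 0) → ‖logVec (su2Quat (X₁ e))‖ ≤ σ)
    (hr : ∀ e, (w b e ≠ 0 ∨ w b' e ≠ 0) → ‖logVec (su2Quat (X e)) - logVec (su2Quat (X₁ e))‖ ≤ r)
    (hδ : ∀ e e', w b e ≠ 0 → w b' e' ≠ 0 →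
      ‖(logVec (su2Quat (X e)) - logVec (su2Quat (X₁ e))) - (logVec (su2Quat (X e')) - logVec (su2Quat (X₁ e')))‖ ≤ δ) :
    ‖logVec (su2Quat (V b * (V₁ b)⁻¹)) - logVec (su2Quat (V b' * (V₁ b')⁻¹))‖ ≤
      (1 + (2 * ((P.L : ℝ)⁻¹ * σ)) ^ 2 / 3) * ((P.L : ℝ)⁻¹ * δ + 16 * (((P.L : ℝ)⁻¹ * σ) * ((P.L : ℝ)⁻¹ * r))) := by
  have hchord := dist1_oscLift_le ht w hw X X₁ V V₁ hV hV₁ b b' (hσ2.trans (by norm_num)) hr1 hσ hr hδ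
  have hL0 : 0 ≤ (P.L : ℝ)⁻¹ := inv_nonneg.mpr (Nat.cast_nonneg _)
  have hL1 : (P.L : ℝ)⁻¹ ≤ 1 := by
    have hL : (1 : ℝ) ≤ (P.L : ℝ) := by exact_mod_cast P.hL.2.le
    exact inv_le_one_of_one_le₀ hL
  -- the two relative arcs are `≤ 2·L⁻¹σ`
  have harc : ∀ b₀ : PBond P t, (∀ e, w b₀ e ≠ 0 → ‖logVec (su2Quat (X e))‖ ≤ σ) → (∀ e, w b₀ e ≠ 0 → ‖logVec (su2Quat (X₁ e))‖ ≤ σ) →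
      ‖logVec (su2Quat (V b₀ * (V₁ b₀)⁻¹))‖ ≤ 2 * ((P.L : ℝ)⁻¹ * σ) := by
    intro b₀ h1 h2
    have hx := arc_lift_le ht w hw X V hV b₀ h1
    have hy := arc_lift_le ht w hw X₁ V₁ hV₁ b₀ h2
    calc ‖logVec (su2Quat (V b₀ * (V₁ b₀)⁻¹))‖ ≤ ‖logVec (su2Quat (V b₀))‖ + ‖logVec (su2Quat (V₁ b₀)⁻¹)‖ := norm_logVec_su2Quat_mul_le _ _
      _ = ‖logVec (su2Quat (V b₀))‖ + ‖logVec (su2Quat (V₁ b₀))‖ := by rw [norm_logVec_su2Quat_inv]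
      _ ≤ 2 * ((P.L : ℝ)⁻¹ * σ) := by linarith
  have ha := harc b (fun e he => hσ e (Or.inl he)) (fun e he => hσ₁ e (Or.inl he))
  have ha' := harc b' (fun e he => hσ e (Or.inr he)) (fun e he => hσ₁ e (Or.inr he))
  -- the Jordan window: `(2L⁻¹σ)² ≤ 1 ≤ 3`
  have hσ0 : 0 ≤ σ := by
    have hLpos : 0 < (P.L : ℝ)⁻¹ := by
      have h2 : (0 : ℝ) < (P.L : ℝ) := by exact_mod_cast lt_trans zero_lt_one P.hL.2
      exact inv_pos.mpr h2
    have hA : ‖logVec (su2Quat (V b))‖ ≤ (P.L : ℝ)⁻¹ * σ := arc_lift_le ht w hw X V hV b fun e he => hσ e (Or.inl he)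
    exact (mul_nonneg_iff_of_pos_left hLpos).mp ((norm_nonneg _).trans hA)
  have hs1 : 2 * ((P.L : ℝ)⁻¹ * σ) ≤ 1 := by
    have : (P.L : ℝ)⁻¹ * σ ≤ σ := mul_le_of_le_one_left hσ0 hL1
    linarith
  have hs0 : 0 ≤ 2 * ((P.L : ℝ)⁻¹ * σ) := by positivity
  have hs3 : (2 * ((P.L : ℝ)⁻¹ * σ)) ^ 2 ≤ 3 := by nlinarith
  have hJ := norm_logVec_sub_le_mul_dist1 (V b * (V₁ b)⁻¹) (V b' * (V₁ b')⁻¹) ha ha' hs3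
  exact hJ.trans (mul_le_mul_of_nonneg_left hchord (by positivity))

end Lift

end Summit.QuantumFields.YangMills.Theorems.FluctuationComparisonRegPrIntLS2BetaOscLift
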